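import Literature.NumberTheory.LFunctions.BurnolCoPoissonMellin
import Literature.NumberTheory.LFunctions.BurnolLPropertyProofs
import Literature.NumberTheory.LFunctions.BurnolMellinTailAverage
import Literature.NumberTheory.LFunctions.BurnolEvaluatorCompletenessProofs
import Literature.NumberTheory.LFunctions.BurnolZetaSystemsSectionSixHolds
import Literature.NumberTheory.LFunctions.BurnolCoPoissonEvaluatorOrthogonality
import Literature.NumberTheory.LFunctions.BurnolZetaSystemsProofs
import Literature.NumberTheory.LFunctions.MuentzFormula
import Literature.Analysis.Complex.PaleyWienerExpType
import Literature.Analysis.Fourier.FourierUniquenessL1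
import Mathlib.Analysis.MellinInversion
import Mathlib.MeasureTheory.Function.Jacobian
import HarnessLib

/-!
# Burnol 2004b, Thm. 3.1: the annihilator of the zero-evaluators in `L_a` IS the co-Poisson
# subspace (`0 < a < 1`), via the classical Paley–Wiener theorem; discharge of `Burnol2004b_thm3_1`

LINE 1 — LABEL: RH-FREE (an identification of `L²` functions from a Mellin-transform identity;
the zeros of `ζ` do not even enter this file). FRAMING (cell rh-crit, D-0074): corpus theorems are
RH-FREE literature; nothing here is worded as progress toward RH. bears_on: B-C/B-P (LADDER-RH
COLUMN 6, de Branges framework) as infrastructure for [Burnol2004b] Thm. 3.1 clause 3 ("For `a < 1`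
the perpendicular complement to `Y_a` is the co-Poisson subspace `P_a`"), the hypothesis `hperp` of
the tree's door `Burnol2004b_thm3_1_of` (`BurnolZetaSystemsProofs.lean`). WHAT THIS IS NOT: not a
criterion, not a route, no statement about the location of zeros; nothing here bears on the truth
of RH.

Topic `NumberTheory/LFunctions` (theorem-only module: no definition, no named fact; net debt −1:
`Burnol2004b_thm3_1_holds`).

## What is PROVED

* `CoPoissonPerp.ae_eq_zero_of_mellin_line_eq_zero` — **`L¹` uniqueness of the Mellin transform on a
  vertical line, almost-everywhere form**: if `∫₀^∞ |k(t)| t^{σ−1} dt < ∞` and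
  `mellin k (σ + iy) = 0` for every real `y`, then `k = 0` a.e. on `(0, ∞)` (Mathlib's
  `mellin_eq_fourier` + the tree's `L¹` Fourier uniqueness + null sets under `u ↦ e^{−u}`).
* `CoPoissonPerp.integrableOn_cpow_mul_tsum` — for a datum `g ∈ L¹(a, 1/a)` and `Re s > 1`,
  `t ↦ t^{−s} Σ_{n≥1} g(t/n)/n` is integrable on `(0, ∞)` (the absolute convergence behind the tree's
  `CoPoissonMellin.integral_cpow_mul_tsum_eq`, [Burnol2004, Note 2.5]).
* **`CoPoissonPerp.mem_coPoissonP_of_rightMellinExt_eq_zeta_mul`** — THE IDENTIFICATION: if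
  `f ∈ L_a` (`0 < a`) and `g ∈ L¹(a, 1/a)` (zero off `(a, 1/a)`) satisfy `G_f(s) = ζ(s)ĝ(s)` for
  `Re s > 1/2`, `s ≠ 1` (`G_f = rightMellinExt f`, `ĝ = rightMellin g`), then `f` IS the co-Poisson sum
  of `g` almost everywhere, hence `f ∈ coPoissonP a`. Printed proof [Burnol2004, proof of Thm. 6.25
  = `omegaprime2`, arXiv:math/0112254 TeX l.2919–2929]: "From Fubini
  `∫_λ^∞ B(u)u^{−s}du = ζ(s)ĝ(s) = Â(s) = ∫_λ^∞ A(u)u^{−s}du` for `Re(s) > 1` and so `B(u) = A(u)`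
  (almost everywhere from the unicity theorem for Fourier transforms of `L¹`-functions)". For `L_a`
  (constants on `(0,a)` instead of zeros) one bookkeeping step is added: comparing residues at
  `s = 1` in `G_f(s) = c·a^{1−s}/(1−s) + ∫_a^∞ f t^{−s}` (★ `BurnolLProperty.rightMellinExt_eq_polar_add_mellin`)
  and `ζ(s)ĝ(s)` pins the constant `c = −ĝ(1)`, which is exactly the constant of the co-Poisson sum
  on `(0, a)`.
* §D — the `⊆` half of Thm. 3.1 clause 3 and the DISCHARGE. For `0 < a < 1` and `f ∈ L_a` with
  `⟪Y^a_{ρ,k}, f⟫ = 0` for all `(ρ, k)`: `θ := G_{f̄}/ζ` is ENTIRE (dbl-iso's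
  ★ `BurnolEvaluatorCompleteness.exists_theta`, the orders at the zeros from
  `le_analyticOrderAt_of_burnolEval_eq_zero` / `burnolEval_conj_eq_zero`);
  `CoPoissonPerp.exists_expType_bound_theta` — `θ` is of EXPONENTIAL TYPE `log(1/a)`: `O(a^{−σ})` on
  `Re s ≥ 2` (`exists_bound_rightMellinExt_exp`: polar part + Cauchy–Schwarz tail
  `≤ a^{1/2−σ}(‖f‖²+1)/2`), the functional equations on `Re s ≤ −1` (`theta_eq_left`), and the
  edges-only maximum-modulus bound between Titchmarsh's good heights in the strip
  (★ `exists_bound_theta_strip_of_edges`); `integrable_sq_theta_line` — `θ ∈ L²(Re s = 2)`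
  (Mellin–Plancherel, ★ `isHardyRight_cpow_mul_rightMellin_of_memLp`); hence the CLASSICAL
  PALEY–WIENER THEOREM (★ `Literature.Analysis.Complex.paleyWiener_of_isEntireOfExpTypeLE`, applied
  to `z ↦ θ(2 − iz)`) writes `θ(s) = ∫ φ(u)e^{(2−s)u}du = ĝ(s)` with `g(x) = φ(log x)·x ∈ L¹(a, 1/a)`,
  so `G_{f̄} = ζ·ĝ` and §C gives `f̄ ∈ P_a`, then `f ∈ P_a` (`star_mem_coPoissonP`):
  **`sonineL_inter_orthogonal_subset_coPoissonP`**, the set identity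
  **`sonineL_inter_orthogonal_eq_coPoissonP`** (= the hypothesis `hperp` of `Burnol2004b_thm3_1_of`;
  `⊇` is ★ `CoPoissonMellin.coPoissonP_subset_sonineL_inter_orthogonal`), and
  **`Burnol2004b_thm3_1_holds : Burnol2004b_thm3_1`** (inputs ★ `prop6_1/6_2/6_4_holds`,
  ★ `thm6_3_holds`).

## DECLARED DEVIATION from the printed proof

Burnol [Burnol2004, proof of Thm. 6.25 with Thm. `kreintheorem` TeX l.2582–2590] obtains the
exponential type of `F = Â/ζ` from KREĬN's theorem (an entire function of Nevanlinna class in two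
complementary half-planes is of exponential type), then `F ∈ L²` of the critical line (Thm. `thml2`) and
Paley–Wiener. Kreĭn's theorem is not in the tree; the exponential type is obtained directly (right
half-plane estimate, functional equation, maximum modulus in the strip — the same elementary route as
the tree's Props. 6.1/6.2), and Paley–Wiener is applied on the line `Re s = 2` (where `θ ∈ L²` is
immediate) rather than on the critical line. Same statement; the zeros of `ζ` enter only as an index
set, wherever they lie.

## References

* [Burnol2004] J.-F. Burnol, *On Fourier and Zeta(s)*, Forum Math. 16 (2004) 789–840 =
  arXiv:math/0112254, Thm. 6.25 (`omegaprime2`, TeX l.2897–2955), Note 2.5.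
* [Burnol2004b] J.-F. Burnol, *Two complete and minimal systems associated with the zeros of the
  Riemann zeta function*, JTNB 16 (2004) 65–94 = arXiv:math/0203120v7, Thm. 3.1 (TeX l.516–525) and
  §6 (TeX l.1294–1300: "we refer the reader to [Burnol2004, Thms. 6.24, 6.25]").
* [Katznelson2004] Y. Katznelson, *An Introduction to Harmonic Analysis*, 3rd ed., Ch. VI §1.11
  (uniqueness theorem for `L¹` Fourier transforms).
-/

noncomputable section

open MeasureTheory Complex Filter Set Asymptotics
open scoped Real Topology FourierTransform ENNReal ComplexConjugate

namespace Literature.NumberTheory.LFunctions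

namespace CoPoissonPerp

/-! ## §A `L¹` uniqueness of the Mellin transform on a vertical line (a.e. form) -/

/-- `u ↦ e^{−u}` is a `C¹` bijection `ℝ → (0,∞)` with derivative `−e^{−u}`. [folklore] -/
private theorem rexp_neg_hasDerivWithinAt :
    ∀ x ∈ (univ : Set ℝ), HasDerivWithinAt (rexp ∘ Neg.neg) (-rexp (-x)) univ x :=
  fun x _ ↦ mul_neg_one (rexp (-x)) ▸
    ((Real.hasDerivAt_exp (-x)).comp x (hasDerivAt_neg x)).hasDerivWithinAt

/-- `u ↦ e^{−u}` maps `ℝ` onto `(0,∞)`. [folklore] -/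
private theorem rexp_neg_image : rexp ∘ Neg.neg '' univ = Ioi 0 := by
  rw [Set.image_comp, Set.image_univ_of_surjective neg_surjective, Set.image_univ, Real.range_exp]

/-- `u ↦ e^{−u}` is injective. [folklore] -/
private theorem rexp_neg_injOn : univ.InjOn (rexp ∘ Neg.neg) :=
  Real.exp_injective.injOn.comp neg_injective.injOn (univ.mapsTo_univ _)

/-- The `L¹` function on the line carried by a Mellin-convergent `k` at `σ`:
`u ↦ e^{−σu} k(e^{−u})` is integrable. [cite: Katznelson2004, Ch. VI §1.11] -/
private theorem integrable_exp_smul_comp {k : ℝ → ℂ} {σ : ℝ} (hk : MellinConvergent k σ) :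
    Integrable (fun u : ℝ ↦ (Real.exp (-σ * u) : ℂ) * k (Real.exp (-u))) := by
  have h := hk
  rw [MellinConvergent, ← rexp_neg_image, integrableOn_image_iff_integrableOn_abs_deriv_smul
    MeasurableSet.univ rexp_neg_hasDerivWithinAt rexp_neg_injOn, integrableOn_univ] at h
  refine (h.congr (Eventually.of_forall fun u ↦ ?_))
  simp only [Function.comp_apply, abs_neg, abs_of_pos (Real.exp_pos _), smul_eq_mul,
    Complex.real_smul]
  have hpos : (0 : ℝ) < Real.exp (-u) := Real.exp_pos _
  rw [show ((σ : ℂ) - 1) = (((σ - 1 : ℝ)) : ℂ) by push_cast; ring]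
  have key : (Real.exp (-u) : ℂ) * ((Real.exp (-u) : ℂ) ^ (((σ - 1 : ℝ)) : ℂ)) =
      (Real.exp (-σ * u) : ℂ) := by
    rw [← Complex.ofReal_cpow hpos.le, ← Complex.ofReal_mul, ← Real.exp_mul, ← Real.exp_add]
    congr 1; ring
  rw [← mul_assoc, key]

/-- **`L¹` uniqueness of the Mellin transform on a vertical line (a.e. form).** If the Mellin
integral of `k` converges absolutely at `σ` and `mellin k` vanishes on the whole line `Re z = σ`,
then `k = 0` almost everywhere on `(0, ∞)`: on the line the Mellin transform is the Fourier
transform of the integrable `u ↦ e^{−σu}k(e^{−u})` (Mathlib's `mellin_eq_fourier`), which then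
vanishes a.e. by the uniqueness theorem for `L¹` Fourier transforms; null sets are carried back to
`(0,∞)` by the smooth map `u ↦ e^{−u}`. [cite: Katznelson2004, Ch. VI §1.11] -/
theorem ae_eq_zero_of_mellin_line_eq_zero {k : ℝ → ℂ} {σ : ℝ} (hk : MellinConvergent k σ)
    (h : ∀ y : ℝ, mellin k (σ + y * I) = 0) :
    ∀ᵐ t : ℝ, t ∈ Ioi (0 : ℝ) → k t = 0 := by
  set G : ℝ → ℂ := fun u ↦ (Real.exp (-σ * u) : ℂ) * k (Real.exp (-u)) with hGdef
  have hGi : Integrable G := integrable_exp_smul_comp hk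
  -- the Fourier transform of `G` vanishes identically
  have hFG : ∀ ξ : ℝ, 𝓕 G ξ = 0 := by
    intro ξ
    have h1 := mellin_eq_fourier k (s := (σ : ℂ) + (2 * π * ξ : ℝ) * I)
    have hre : ((σ : ℂ) + (2 * π * ξ : ℝ) * I).re = σ := by simp
    have him : ((σ : ℂ) + (2 * π * ξ : ℝ) * I).im / (2 * π) = ξ := by
      simp only [add_im, ofReal_im, mul_im, ofReal_re, I_im, mul_one, I_re, mul_zero,
        add_zero, zero_add]
      field_simp
    rw [hre, him, h] at h1
    have hG' : (fun u : ℝ ↦ (Real.exp (-σ * u) : ℝ) • k (Real.exp (-u))) = G := by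
      funext u; simp [hGdef, Complex.real_smul]
    rw [hG'] at h1
    exact h1.symm
  have hG0 : G =ᵐ[volume] 0 :=
    Literature.Analysis.Fourier.ae_eq_zero_of_forall_fourier_eq_zero hGi hFG
  -- the null set `{u | k(e^{-u}) ≠ 0}` and its image under `u ↦ e^{-u}`
  have hN : volume {u : ℝ | k (Real.exp (-u)) ≠ 0} = 0 := by
    have : {u : ℝ | k (Real.exp (-u)) ≠ 0} ⊆ {u : ℝ | G u ≠ (0 : ℝ → ℂ) u} := by
      intro u hu hGu
      apply hu
      simp only [hGdef, Pi.zero_apply, mul_eq_zero, ofReal_eq_zero] at hGu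
      exact hGu.resolve_left (Real.exp_pos _).ne'
    exact measure_mono_null this (ae_iff.1 hG0)
  have himg : volume ((rexp ∘ Neg.neg) '' {u : ℝ | k (Real.exp (-u)) ≠ 0}) = 0 :=
    addHaar_image_eq_zero_of_differentiableOn_of_addHaar_eq_zero volume
      ((Real.differentiable_exp.comp differentiable_neg).differentiableOn) hN
  have hsub : {t : ℝ | t ∈ Ioi (0 : ℝ) ∧ k t ≠ 0} ⊆
      (rexp ∘ Neg.neg) '' {u : ℝ | k (Real.exp (-u)) ≠ 0} := by
    rintro t ⟨ht, hkt⟩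
    refine ⟨-Real.log t, ?_, ?_⟩
    · show k (Real.exp (-(-Real.log t))) ≠ 0
      rwa [neg_neg, Real.exp_log ht]
    · show Real.exp (-(-Real.log t)) = t
      rw [neg_neg, Real.exp_log ht]
  have hnull : volume {t : ℝ | t ∈ Ioi (0 : ℝ) ∧ k t ≠ 0} = 0 := measure_mono_null hsub himg
  rw [ae_iff]
  refine measure_mono_null (fun t ht ↦ ?_) hnull
  simp only [Classical.not_imp, mem_setOf_eq] at ht
  exact ⟨ht.1, ht.2⟩

/-! ## §B Absolute convergence of `∫₀^∞ t^{−s} Σ_{n≥1} g(t/n)/n dt` for `Re s > 1` -/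

variable {a : ℝ} {g : ℝ → ℂ}

/-- **`t ↦ t^{−s} Σ_{n≥1} g(|t|/n)/n` is integrable on `(0,∞)` for `Re s > 1`** (`g ∈ L¹` supported in
`[a, 1/a] ⊂ (0,∞)`): the terms have `L¹` norms `(n+1)^{−σ} ∫₀^∞ u^{−σ}|g(u)|du`, a summable sequence
("For `Re(s) > 1` we may intervert the integral with the summation"). This is the absolute
convergence underlying the tree's `CoPoissonMellin.integral_cpow_mul_tsum_eq`.
[cite: Burnol2004, Note 2.5 (TeX l.737–743)] -/
theorem integrableOn_cpow_mul_tsum (ha : 0 < a) (hgi : IntegrableOn g (Ioo a a⁻¹))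
    (hgz : ∀ t, t ∉ Ioo a a⁻¹ → g t = 0) {s : ℂ} (hs : 1 < s.re) :
    IntegrableOn (fun t : ℝ ↦ (t : ℂ) ^ (-s) * ∑' n : ℕ, g (|t| / ((n : ℝ) + 1)) / ((n : ℂ) + 1))
      (Ioi 0) := by
  set σ : ℝ := s.re with hσ
  set F : ℕ → ℝ → ℂ := fun n t ↦ (t : ℂ) ^ (-s) * (g (|t| / ((n : ℝ) + 1)) / ((n : ℂ) + 1)) with hF
  have hconv : MellinConvergent g (1 - s) := CoPoissonMellin.mellinConvergent_datum ha hgi hgz (1 - s)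
  have hm : ∀ n : ℕ, (0 : ℝ) < (n : ℝ) + 1 := fun n ↦ by positivity
  -- integrability of each piece on `(0, ∞)`
  have hFint : ∀ n, Integrable (F n) (volume.restrict (Ioi 0)) := by
    intro n
    have h1 : MellinConvergent (fun t ↦ g (((n : ℝ) + 1)⁻¹ * t)) (1 - s) :=
      (MellinConvergent.comp_mul_left (inv_pos.2 (hm n))).2 hconv
    have h2 : Integrable (fun t : ℝ ↦ ((n : ℂ) + 1)⁻¹ *
        ((t : ℂ) ^ (1 - s - 1) • g (((n : ℝ) + 1)⁻¹ * t))) (volume.restrict (Ioi 0)) :=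
      h1.const_mul _
    refine h2.congr ?_
    filter_upwards [ae_restrict_mem measurableSet_Ioi] with t ht
    have ht0 : (0 : ℝ) < t := ht
    simp only [hF, smul_eq_mul, sub_sub_cancel_left, abs_of_pos ht0, div_eq_mul_inv,
      mul_comm t]
    ring
  -- the norms: `∫‖F n‖ = (n+1)^{-σ} ∫₀^∞ u^{-σ}‖g u‖du`
  set G : ℝ := ∫ u in Ioi (0 : ℝ), u ^ (-σ) * ‖g u‖ with hG
  have hnormF : ∀ (n : ℕ) (t : ℝ), 0 < t →
      ‖F n t‖ = ((n : ℝ) + 1)⁻¹ * (t ^ (-σ) * ‖g (t / ((n : ℝ) + 1))‖) := by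
    intro n t ht
    simp only [hF, norm_mul, norm_div, norm_cpow_eq_rpow_re_of_pos ht, neg_re, abs_of_pos ht]
    have : ‖(n : ℂ) + 1‖ = (n : ℝ) + 1 := by
      rw [show (n : ℂ) + 1 = (((n : ℝ) + 1 : ℝ) : ℂ) by push_cast; rfl, Complex.norm_real,
        Real.norm_of_nonneg (hm n).le]
    rw [this]
    ring
  have hFnorm : ∀ n : ℕ, ∫ t in Ioi (0 : ℝ), ‖F n t‖ = ((n : ℝ) + 1) ^ (-σ) * G := by
    intro n
    have hmn := hm n
    have h1 : ∫ t in Ioi (0 : ℝ), ‖F n t‖ =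
        ∫ t in Ioi (0 : ℝ), ((n : ℝ) + 1)⁻¹ * (t ^ (-σ) * ‖g (t / ((n : ℝ) + 1))‖) :=
      setIntegral_congr_fun measurableSet_Ioi fun t ht ↦ hnormF n t ht
    have h2 : ∫ t in Ioi (0 : ℝ), t ^ (-σ) * ‖g (t / ((n : ℝ) + 1))‖ =
        ((n : ℝ) + 1) ^ (1 - σ) * G := by
      have hsub := integral_comp_mul_left_Ioi
        (fun t : ℝ ↦ t ^ (-σ) * ‖g (t / ((n : ℝ) + 1))‖) 0 hmn
      rw [mul_zero] at hsub
      have hfun : (fun u : ℝ ↦ (fun t : ℝ ↦ t ^ (-σ) * ‖g (t / ((n : ℝ) + 1))‖)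
          (((n : ℝ) + 1) * u)) = fun u ↦ ((n : ℝ) + 1) ^ (-σ) * (u ^ (-σ) * ‖g u‖) := by
        funext u
        simp only
        rw [mul_div_cancel_left₀ u hmn.ne']
        by_cases hu : 0 ≤ u
        · rw [Real.mul_rpow hmn.le hu]; ring
        · have hu' : u ∉ Ioo a a⁻¹ := fun h ↦ hu (ha.le.trans h.1.le)
          rw [hgz u hu', norm_zero, mul_zero, mul_zero, mul_zero]
      rw [hfun, integral_const_mul] at hsub
      rw [smul_eq_mul] at hsub
      have : ∫ t in Ioi (0 : ℝ), t ^ (-σ) * ‖g (t / ((n : ℝ) + 1))‖ =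
          ((n : ℝ) + 1) * (((n : ℝ) + 1) ^ (-σ) * G) := by
        rw [hsub]; field_simp
      rw [this, ← mul_assoc, Real.rpow_sub hmn, Real.rpow_one, Real.rpow_neg hmn.le]
      field_simp
    rw [h1, integral_const_mul, h2, ← mul_assoc, Real.rpow_sub hmn, Real.rpow_one,
      Real.rpow_neg hmn.le]
    field_simp
  have hsum : Summable fun n ↦ ∫ t in Ioi (0 : ℝ), ‖F n t‖ := by
    simp_rw [hFnorm]
    refine Summable.mul_right _ ?_
    have h := (summable_nat_add_iff 1).2 (Real.summable_nat_rpow.2 (by linarith : -σ < -1))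
    exact_mod_cast h
  have hI := integrable_tsum_of_summable_integral_norm hFint hsum
  refine hI.congr (Eventually.of_forall fun t ↦ ?_)
  simp only [hF]
  rw [tsum_mul_left]

/-! ## §C The identification `G_f = ζ·ĝ ⇒ f = coPoissonSum g` a.e. -/

/-- The tail transform is the Mellin transform of the truncation: for every `s`,
`mellin (𝟙_{(a,∞)}F) (1 − s) = ∫_a^∞ t^{−s} F(t) dt`. [folklore] -/
private theorem mellin_indicator_eq_setIntegral (ha : 0 < a) (F : ℝ → ℂ) (s : ℂ) :
    mellin ((Ioi a).indicator F) (1 - s) = ∫ t in Ioi a, (t : ℂ) ^ (-s) * F t := by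
  simp only [mellin, smul_eq_mul, sub_sub_cancel_left]
  have hind : (fun t : ℝ ↦ (t : ℂ) ^ (-s) * (Ioi a).indicator F t) =
      (Ioi a).indicator (fun t : ℝ ↦ (t : ℂ) ^ (-s) * F t) := by
    funext t
    by_cases ht : t ∈ Ioi a
    · rw [indicator_of_mem ht, indicator_of_mem ht]
    · rw [indicator_of_notMem ht, indicator_of_notMem ht, mul_zero]
  rw [hind, setIntegral_indicator measurableSet_Ioi,
    show Ioi (0 : ℝ) ∩ Ioi a = Ioi a from by rw [inter_eq_right]; exact Ioi_subset_Ioi ha.le]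

/-- The co-Poisson sum equals `−ĝ(1)` on `(0, a]` (`ĝ(1) = ∫₀^∞ g(u)du/u`).
[cite: Burnol2004b, §2 (arXiv:math/0203120v7 p. 5, TeX l.397–401)] -/
theorem coPoissonSum_eq_of_le (hgz : ∀ t, t ∉ Ioo a a⁻¹ → g t = 0) {t : ℝ} (ht0 : 0 < t)
    (hta : t ≤ a) : coPoissonSum g t = -∫ u in Ioi (0 : ℝ), g u / (u : ℂ) := by
  rw [coPoissonSum, CoPoissonMellin.tsum_eq_zero_of_le hgz ht0 hta, zero_sub]

/-- **The tail transform of the co-Poisson sum for `Re s > 1`, for a bare `L¹` datum** (no `L²`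
hypothesis on the sum): `t ↦ t^{−s}·coPoissonSum g (t)` is integrable on `(a, ∞)` and
`∫_a^∞ t^{−s} (Σ_{n≥1} g(t/n)/n − ĝ(1)) dt = ζ(s)ĝ(s) + ĝ(1)·a^{1−s}/(1−s)`.
[cite: Burnol2004, Note 2.5 (TeX l.737–750); Burnol2004b, §2 (arXiv:math/0203120v7 p. 5, TeX l.393–404)] -/
theorem setIntegral_cpow_mul_coPoissonSum (ha : 0 < a) (hgi : IntegrableOn g (Ioo a a⁻¹))
    (hgz : ∀ t, t ∉ Ioo a a⁻¹ → g t = 0) {s : ℂ} (hs : 1 < s.re) :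
    IntegrableOn (fun t : ℝ ↦ (t : ℂ) ^ (-s) * coPoissonSum g t) (Ioi a) ∧
      ∫ t in Ioi a, (t : ℂ) ^ (-s) * coPoissonSum g t =
        riemannZeta s * rightMellin g s +
          (∫ u in Ioi (0 : ℝ), g u / (u : ℂ)) * (a : ℂ) ^ (1 - s) / (1 - s) := by
  set c : ℂ := ∫ u in Ioi (0 : ℝ), g u / (u : ℂ) with hc
  set S : ℝ → ℂ := fun t ↦ ∑' n : ℕ, g (|t| / ((n : ℝ) + 1)) / ((n : ℂ) + 1) with hS
  have hs1 : 1 - s ≠ 0 := by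
    intro h
    have := congrArg Complex.re h
    simp only [sub_re, one_re, zero_re] at this
    linarith
  have hneg : (-s).re < -1 := by simp only [neg_re]; linarith
  -- the two pieces on `(a, ∞)`
  have hSint : IntegrableOn (fun t : ℝ ↦ (t : ℂ) ^ (-s) * S t) (Ioi a) :=
    (integrableOn_cpow_mul_tsum ha hgi hgz hs).mono_set (Ioi_subset_Ioi ha.le)
  have hcint : IntegrableOn (fun t : ℝ ↦ (t : ℂ) ^ (-s) * c) (Ioi a) :=
    (integrableOn_Ioi_cpow_of_lt hneg ha).mul_const c
  have hsplit : (fun t : ℝ ↦ (t : ℂ) ^ (-s) * coPoissonSum g t) =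
      fun t : ℝ ↦ (t : ℂ) ^ (-s) * S t - (t : ℂ) ^ (-s) * c := by
    funext t
    simp only [coPoissonSum, hS, hc]
    ring
  refine ⟨by rw [hsplit]; exact hSint.sub hcint, ?_⟩
  rw [hsplit, integral_sub hSint hcint]
  -- `∫_a^∞ t^{-s} S = ∫_0^∞ t^{-s} S = ζ(s) ĝ(s)` (the sum vanishes on `(0,a]`)
  have hS0 : ∫ t in Ioi a, (t : ℂ) ^ (-s) * S t = ∫ t in Ioi (0 : ℝ), (t : ℂ) ^ (-s) * S t := by
    symm
    rw [← integral_indicator measurableSet_Ioi, ← integral_indicator measurableSet_Ioi]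
    refine integral_congr_ae (Eventually.of_forall fun t ↦ ?_)
    by_cases hta : t ∈ Ioi a
    · have ht0 : t ∈ Ioi (0 : ℝ) := Ioi_subset_Ioi ha.le hta
      rw [indicator_of_mem ht0, indicator_of_mem hta]
    · rw [indicator_of_notMem hta]
      by_cases ht0 : t ∈ Ioi (0 : ℝ)
      · rw [indicator_of_mem ht0]
        have : S t = 0 := CoPoissonMellin.tsum_eq_zero_of_le hgz ht0 (not_lt.1 hta)
        rw [this, mul_zero]
      · rw [indicator_of_notMem ht0]
  rw [hS0, CoPoissonMellin.integral_cpow_mul_tsum_eq ha hgi hgz hs, integral_mul_const,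
    integral_Ioi_cpow_of_lt hneg ha]
  have e1 : (-s : ℂ) + 1 = 1 - s := by ring
  rw [e1]
  field_simp
  ring

/-- `∀ᵐ`-transport through `x ↦ −x`: an a.e. statement on `(0,∞)` gives one on `(−∞,0)`.
[folklore] -/
private theorem ae_neg_of_ae_pos {p : ℝ → Prop} (h : ∀ᵐ x : ℝ, 0 < x → p x) :
    ∀ᵐ x : ℝ, x < 0 → p (-x) := by
  have := (Measure.measurePreserving_neg (volume : Measure ℝ)).quasiMeasurePreserving.ae h
  filter_upwards [this] with x hx hx0
  exact hx (by linarith)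

/-- **The identification.** Let `0 < a`, `f ∈ L_a`, and let `g ∈ L¹(a, 1/a)` (zero off `(a, 1/a)`)
be a datum with `G_f(s) = ζ(s)ĝ(s)` for `Re s > 1/2`, `s ≠ 1`. Then `f` is the co-Poisson sum of
`g` almost everywhere: `f = Σ_{n≥1} g(|t|/n)/n − ĝ(1)` a.e. on `ℝ`. Printed (for `K_λ`): "From Fubini
`∫_λ^∞ B(u)u^{−s}du = ζ(s)ĝ(s) = Â(s) = ∫_λ^∞ A(u)u^{−s}du` for `Re(s) > 1` and so `B(u) = A(u)`
(almost everywhere from the unicity theorem for Fourier transforms of `L¹`-functions)"; for `L_a` the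
constant on `(0,a)` is first pinned to `−ĝ(1)` by comparing residues at `s = 1`.
[cite: Burnol2004, proof of Thm. 6.25 (`omegaprime2`, TeX l.2919–2929); Burnol2004b, Thm. 3.1 clause 3 (arXiv:math/0203120v7 p. 6, TeX l.516–525)] -/
theorem ae_eq_coPoissonSum_of_rightMellinExt_eq_zeta_mul (ha : 0 < a)
    {f : Lp ℂ 2 (volume : Measure ℝ)} (hf : f ∈ sonineL a)
    (hgi : IntegrableOn g (Ioo a a⁻¹)) (hgz : ∀ t, t ∉ Ioo a a⁻¹ → g t = 0)
    (hG : ∀ s : ℂ, 1 / 2 < s.re → s ≠ 1 → riemannZeta s ≠ 0 →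
      rightMellinExt f s = riemannZeta s * rightMellin g s) :
    ∀ᵐ t : ℝ, f t = coPoissonSum g t := by
  obtain ⟨c, hfc⟩ := hf.2.1
  have hex : ∃ G, HasRightMellinContinuation f G :=
    ⟨_, hasRightMellinContinuation_rightMellinExt_of_mem_sonineL ha hf⟩
  set ĝ1 : ℂ := ∫ u in Ioi (0 : ℝ), g u / (u : ℂ) with hĝ1
  have hĝ1' : rightMellin g 1 = ĝ1 := CoPoissonMellin.rightMellin_datum_one g
  set M : ℂ → ℂ := fun s ↦ mellin ((Ioi a).indicator (f : ℝ → ℂ)) (1 - s) with hMdef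
  -- (★) `M(s) = ζ(s)ĝ(s) − c·a^{1−s}/(1−s)` on `{Re s > 1/2} ∖ {1}`
  have hstar : ∀ s : ℂ, 1 / 2 < s.re → s ≠ 1 → riemannZeta s ≠ 0 →
      M s = riemannZeta s * rightMellin g s - c * (a : ℂ) ^ (1 - s) / (1 - s) := by
    intro s hs hs1 hζ
    have h1 := BurnolLProperty.rightMellinExt_eq_polar_add_mellin ha hfc hex hs hs1
    rw [hG s hs hs1 hζ] at h1
    rw [hMdef]
    linear_combination -h1
  -- Step 1: residues at `s = 1` give `c = −ĝ(1)`
  have hU : {s : ℂ | 1 / 2 < s.re} ∈ 𝓝 (1 : ℂ) :=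
    (isOpen_lt continuous_const Complex.continuous_re).mem_nhds (by simp; norm_num)
  have hMcont : ContinuousAt M 1 :=
    ((CoPoissonMellin.differentiableOn_mellin_indicator ha f).differentiableAt hU).continuousAt
  have hĝcont : ContinuousAt (rightMellin g) 1 :=
    (CoPoissonMellin.differentiable_rightMellin_datum ha hgi hgz 1).continuousAt
  have hpow : ContinuousAt (fun s : ℂ ↦ c * (a : ℂ) ^ (1 - s)) 1 :=
    (((continuous_const.sub continuous_id).const_cpow
      (Or.inl (ofReal_ne_zero.2 ha.ne'))).const_mul c).continuousAt
  have hlim1 : Tendsto (fun s : ℂ ↦ (s - 1) * M s) (𝓝[≠] 1) (𝓝 0) := by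
    have : Tendsto (fun s : ℂ ↦ (s - 1) * M s) (𝓝 1) (𝓝 ((1 - 1) * M 1)) :=
      ((continuous_id.sub continuous_const).continuousAt.mul hMcont).tendsto
    rw [sub_self, zero_mul] at this
    exact this.mono_left nhdsWithin_le_nhds
  have hlim2 : Tendsto (fun s : ℂ ↦ (s - 1) * M s) (𝓝[≠] 1) (𝓝 (1 * rightMellin g 1 + c * 1)) := by
    have hev : (fun s : ℂ ↦ (s - 1) * riemannZeta s * rightMellin g s + c * (a : ℂ) ^ (1 - s))
        =ᶠ[𝓝[≠] (1 : ℂ)] fun s ↦ (s - 1) * M s := by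
      -- near `s = 1`, `ζ(s) ≠ 0` (the pole): `(s−1)ζ(s) → 1`
      have hζne : ∀ᶠ s : ℂ in 𝓝[≠] (1 : ℂ), riemannZeta s ≠ 0 := by
        filter_upwards [riemannZeta_residue_one.eventually_ne one_ne_zero] with s hs h0
        exact hs (by rw [h0, mul_zero])
      filter_upwards [self_mem_nhdsWithin, mem_nhdsWithin_of_mem_nhds hU, hζne] with s hs1 hs hζ
      rw [hstar s hs hs1 hζ]
      have h1s : (1 : ℂ) - s ≠ 0 := sub_ne_zero.2 (Ne.symm hs1)
      field_simp
      ring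
    refine Tendsto.congr' hev ?_
    have hz := riemannZeta_residue_one
    have hA : Tendsto (fun s : ℂ ↦ (s - 1) * riemannZeta s * rightMellin g s) (𝓝[≠] 1)
        (𝓝 (1 * rightMellin g 1)) := hz.mul (hĝcont.tendsto.mono_left nhdsWithin_le_nhds)
    have hB : Tendsto (fun s : ℂ ↦ c * (a : ℂ) ^ (1 - s)) (𝓝[≠] 1) (𝓝 (c * 1)) := by
      have := hpow.tendsto.mono_left (nhdsWithin_le_nhds (s := {(1 : ℂ)}ᶜ))
      simpa using this
    exact hA.add hB
  have hc : c = -ĝ1 := by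
    have := tendsto_nhds_unique hlim2 hlim1
    rw [one_mul, mul_one, hĝ1'] at this
    linear_combination this
  -- Step 2: for `Re s > 1` the two tail transforms agree
  have htail : ∀ s : ℂ, 1 < s.re →
      M s = ∫ t in Ioi a, (t : ℂ) ^ (-s) * coPoissonSum g t := by
    intro s hs
    have hs' : 1 / 2 < s.re := by linarith
    have hs1 : s ≠ 1 := fun h ↦ by rw [h, one_re] at hs; exact lt_irrefl _ hs
    have hζ : riemannZeta s ≠ 0 := riemannZeta_ne_zero_of_one_lt_re hs
    rw [hstar s hs' hs1 hζ, (setIntegral_cpow_mul_coPoissonSum ha hgi hgz hs).2, hc, hĝ1]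
    ring
  -- Step 3: `h := 𝟙_{(a,∞)}(f − coPoissonSum g)` has vanishing Mellin transform on `Re = −1`
  set h : ℝ → ℂ := (Ioi a).indicator (fun t ↦ (f : ℝ → ℂ) t - coPoissonSum g t) with hhdef
  have hfint : ∀ s : ℂ, 1 / 2 < s.re →
      IntegrableOn (fun t : ℝ ↦ (t : ℂ) ^ (-s) * (f : ℝ → ℂ) t) (Ioi a) :=
    fun s hs ↦ BurnolTailAvg.integrableOn_cpow_mul ha (Lp.memLp f) hs
  have hmellin_h : ∀ s : ℂ, 1 < s.re → mellin h (1 - s) = 0 := by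
    intro s hs
    have hs' : 1 / 2 < s.re := by linarith
    rw [hhdef, mellin_indicator_eq_setIntegral ha]
    have hP := (setIntegral_cpow_mul_coPoissonSum ha hgi hgz hs).1
    have : (fun t : ℝ ↦ (t : ℂ) ^ (-s) * ((f : ℝ → ℂ) t - coPoissonSum g t)) =
        fun t : ℝ ↦ (t : ℂ) ^ (-s) * (f : ℝ → ℂ) t - (t : ℂ) ^ (-s) * coPoissonSum g t := by
      funext t; ring
    rw [this, integral_sub (hfint s hs') hP, ← htail s hs]
    simp only [hMdef, mellin_indicator_eq_setIntegral ha, sub_self]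
  have hconv : MellinConvergent h ((-1 : ℝ) : ℂ) := by
    -- `t^{-2} h(t)` is integrable on `(0,∞)`: it is `𝟙_{(a,∞)} t^{-2}(f − P)`
    have h2 : (1 : ℝ) < (2 : ℂ).re := by norm_num
    have hI : IntegrableOn (fun t : ℝ ↦ (t : ℂ) ^ (-(2 : ℂ)) * ((f : ℝ → ℂ) t - coPoissonSum g t))
        (Ioi a) := by
      have : (fun t : ℝ ↦ (t : ℂ) ^ (-(2 : ℂ)) * ((f : ℝ → ℂ) t - coPoissonSum g t)) =
          fun t : ℝ ↦ (t : ℂ) ^ (-(2 : ℂ)) * (f : ℝ → ℂ) t - (t : ℂ) ^ (-(2 : ℂ)) * coPoissonSum g t := by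
        funext t; ring
      rw [this]
      exact (hfint 2 (by norm_num)).sub (setIntegral_cpow_mul_coPoissonSum ha hgi hgz h2).1
    rw [MellinConvergent, hhdef]
    have hind : (fun t : ℝ ↦ (t : ℂ) ^ (((-1 : ℝ) : ℂ) - 1) •
        (Ioi a).indicator (fun t ↦ (f : ℝ → ℂ) t - coPoissonSum g t) t) =
        (Ioi a).indicator (fun t : ℝ ↦ (t : ℂ) ^ (-(2 : ℂ)) * ((f : ℝ → ℂ) t - coPoissonSum g t)) := by
      funext t
      rw [smul_eq_mul, show (((-1 : ℝ) : ℂ) - 1) = -(2 : ℂ) by push_cast; norm_num]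
      by_cases ht : t ∈ Ioi a
      · rw [indicator_of_mem ht, indicator_of_mem ht]
      · rw [indicator_of_notMem ht, indicator_of_notMem ht, mul_zero]
    rw [hind, integrableOn_indicator_iff measurableSet_Ioi]
    exact hI.mono_set inter_subset_left
  have hline : ∀ y : ℝ, mellin h (((-1 : ℝ) : ℂ) + y * I) = 0 := by
    intro y
    have := hmellin_h (2 - y * I) (by simp)
    rw [show (1 : ℂ) - (2 - y * I) = ((-1 : ℝ) : ℂ) + y * I by push_cast; ring] at this
    exact this
  have hzero := ae_eq_zero_of_mellin_line_eq_zero hconv hline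
  -- Step 4: assemble the a.e. identity on `ℝ`
  have hpos : ∀ᵐ t : ℝ, 0 < t → (f : ℝ → ℂ) t = coPoissonSum g t := by
    have hpt : ∀ᵐ t : ℝ, t ≠ a := by
      have : volume ({a} : Set ℝ) = 0 := measure_singleton a
      exact compl_mem_ae_iff.2 this
    filter_upwards [hzero, hfc, hpt] with t hgt hlt hne ht0
    rcases lt_or_gt_of_ne hne with hta | hta
    · -- `0 < t < a`: both sides are the constant `c = −ĝ(1)`
      rw [hlt ⟨ht0, hta⟩, coPoissonSum_eq_of_le hgz ht0 hta.le, hc]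
    · -- `a < t`: from the Mellin uniqueness
      have := hgt ht0
      rw [hhdef, indicator_of_mem (show t ∈ Ioi a from hta)] at this
      exact sub_eq_zero.1 this
  have hneg := ae_neg_of_ae_pos hpos
  have h0 : ∀ᵐ t : ℝ, t ≠ 0 := compl_mem_ae_iff.2 (measure_singleton (0 : ℝ))
  filter_upwards [hpos, hneg, hf.1, h0] with t ht1 ht2 heven ht0
  rcases lt_or_gt_of_ne ht0 with hlt | hgt
  · -- `t < 0`: evenness of `f` and of the co-Poisson sum
    have h1 := ht2 hlt
    rw [heven] at h1
    rw [h1, coPoissonSum, coPoissonSum, abs_neg]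
  · exact ht1 hgt

/-- **`G_f = ζ·ĝ ⇒ f ∈ P_a`.** Under the hypotheses of
`ae_eq_coPoissonSum_of_rightMellinExt_eq_zeta_mul`, `f` belongs to the co-Poisson subspace
`coPoissonP a` (with datum `g`). [cite: Burnol2004, Thm. 6.25 (`omegaprime2`, TeX l.2897–2929); Burnol2004b, Thm. 3.1 clause 3 (arXiv:math/0203120v7 p. 6, TeX l.516–525)] -/
theorem mem_coPoissonP_of_rightMellinExt_eq_zeta_mul (ha : 0 < a)
    {f : Lp ℂ 2 (volume : Measure ℝ)} (hf : f ∈ sonineL a)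
    (hgi : IntegrableOn g (Ioo a a⁻¹)) (hgz : ∀ t, t ∉ Ioo a a⁻¹ → g t = 0)
    (hG : ∀ s : ℂ, 1 / 2 < s.re → s ≠ 1 → riemannZeta s ≠ 0 →
      rightMellinExt f s = riemannZeta s * rightMellin g s) :
    f ∈ coPoissonP a :=
  ⟨g, hgi, hgz, ae_eq_coPoissonSum_of_rightMellinExt_eq_zeta_mul ha hf hgi hgz hG⟩


/-! ## §D The annihilator of the `Y^a_{ρ,k}` in `L_a` (`0 < a < 1`): `θ = G_f/ζ` is entire of
exponential type `log(1/a)`, `L²` on `Re s = 2`, hence (Paley–Wiener) a Mellin transform `ĝ`,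
`g ∈ L²(a, 1/a)`; then §C. -/

section Assembly

variable {f : Lp ℂ 2 (volume : Measure ℝ)} {θ : ℂ → ℂ}

/-- Polynomials are of exponential type zero: `(1+x)^M ≤ M!·ε^{−M}·e^{ε}·e^{εx}` for `x ≥ 0`, `ε > 0`.
[folklore] -/
private theorem exists_pow_le_exp (M : ℕ) {ε : ℝ} (hε : 0 < ε) :
    ∃ C : ℝ, 0 ≤ C ∧ ∀ x : ℝ, 0 ≤ x → (1 + x) ^ M ≤ C * Real.exp (ε * x) := by
  refine ⟨(M.factorial : ℝ) * ε⁻¹ ^ M * Real.exp ε, by positivity, fun x hx ↦ ?_⟩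
  have h := Real.pow_div_factorial_le_exp (ε * (1 + x)) (by positivity) M
  rw [div_le_iff₀ (by positivity)] at h
  have hεM : 0 < ε ^ M := pow_pos hε M
  calc (1 + x) ^ M = (ε * (1 + x)) ^ M * ε⁻¹ ^ M := by
        rw [mul_pow, inv_pow, mul_assoc, mul_comm ((1 + x) ^ M), ← mul_assoc,
          mul_inv_cancel₀ hεM.ne', one_mul]
    _ ≤ Real.exp (ε * (1 + x)) * M.factorial * ε⁻¹ ^ M := by gcongr
    _ = (M.factorial : ℝ) * ε⁻¹ ^ M * Real.exp ε * Real.exp (ε * x) := by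
        rw [mul_add, mul_one, Real.exp_add]; ring

/-- **Right half-plane bound of exponential type `log(1/a)`** for `v ∈ L_a`, `0 < a ≤ 1`:
`‖G_v(s)‖ ≤ K·e^{−(log a)·Re s}` on `Re s ≥ 2` (`G_v(s) = c·a^{1−s}/(1−s) + ∫_a^∞ v t^{−s}`, the tail by
Cauchy–Schwarz `≤ a^{1/2−σ}(‖v‖²+1)/2`). [cite: Burnol2004b, proof of Thm. 4.8 ("`G(s)` is `O(A^{Re s})`", arXiv:math/0203120v7 p. 10, TeX l.857–858)] -/
theorem exists_bound_rightMellinExt_exp {a : ℝ} (ha : 0 < a) (ha1 : a ≤ 1)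
    {v : Lp ℂ 2 (volume : Measure ℝ)} (hv : v ∈ sonineL a) :
    ∃ K : ℝ, 0 ≤ K ∧ ∀ s : ℂ, 2 ≤ s.re →
      ‖rightMellinExt v s‖ ≤ K * Real.exp (-Real.log a * s.re) := by
  obtain ⟨c, hvc⟩ := hv.2.1
  have hex : ∃ G, HasRightMellinContinuation v G :=
    ⟨_, hasRightMellinContinuation_rightMellinExt_of_mem_sonineL ha hv⟩
  refine ⟨‖c‖ + (‖v‖ ^ 2 + 1) / 2, by positivity, fun s hs ↦ ?_⟩
  have hs' : 1 / 2 < s.re := by linarith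
  have hs1 : s ≠ 1 := by intro h; rw [h, one_re] at hs; norm_num at hs
  set E : ℝ := Real.exp (-Real.log a * s.re) with hE
  have hE0 : 0 < E := Real.exp_pos _
  have hpow : ∀ x : ℝ, a ^ x = Real.exp (Real.log a * x) := fun x ↦ Real.rpow_def_of_pos ha x
  have hloga : Real.log a ≤ 0 := Real.log_nonpos ha.le ha1
  -- `a^{1−σ} ≤ E` and `√(a^{1−2σ}/(2σ−1)) ≤ E`
  have h1 : a ^ (1 - s.re) ≤ E := by
    rw [hpow, hE, Real.exp_le_exp]; nlinarith
  have h2 : Real.sqrt (a ^ (1 - 2 * s.re) / (2 * s.re - 1)) ≤ E := by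
    have hB : a ^ (1 - 2 * s.re) / (2 * s.re - 1) ≤ E ^ 2 := by
      have hden : 1 ≤ 2 * s.re - 1 := by linarith
      have hnum : a ^ (1 - 2 * s.re) ≤ E ^ 2 := by
        rw [hpow, hE, ← Real.exp_nat_mul, Real.exp_le_exp]; push_cast; nlinarith
      calc a ^ (1 - 2 * s.re) / (2 * s.re - 1) ≤ a ^ (1 - 2 * s.re) / 1 :=
            div_le_div_of_nonneg_left (Real.rpow_nonneg ha.le _) one_pos hden
        _ ≤ E ^ 2 := by rw [div_one]; exact hnum
    calc Real.sqrt (a ^ (1 - 2 * s.re) / (2 * s.re - 1)) ≤ Real.sqrt (E ^ 2) :=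
          Real.sqrt_le_sqrt hB
      _ = E := Real.sqrt_sq hE0.le
  rw [BurnolLProperty.rightMellinExt_eq_polar_add_mellin ha hvc hex hs' hs1]
  refine (norm_add_le _ _).trans ?_
  have hpolar : ‖c * (a : ℂ) ^ (1 - s) / (1 - s)‖ ≤ ‖c‖ * E := by
    rw [norm_div, norm_mul, norm_cpow_eq_rpow_re_of_pos ha, sub_re, one_re]
    have hn : 1 ≤ ‖1 - s‖ := by
      calc (1 : ℝ) ≤ |(1 - s).re| := by
            rw [sub_re, one_re, abs_of_nonpos (by linarith)]; linarith
        _ ≤ ‖1 - s‖ := abs_re_le_norm _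
    calc ‖c‖ * a ^ (1 - s.re) / ‖1 - s‖ ≤ ‖c‖ * a ^ (1 - s.re) / 1 :=
          div_le_div_of_nonneg_left (by positivity) one_pos hn
      _ ≤ ‖c‖ * E := by rw [div_one]; gcongr
  have htail := BurnolEvaluatorCompleteness.norm_tail_le ha v hs'
  have htail' : ‖mellin ((Ioi a).indicator (v : ℝ → ℂ)) (1 - s)‖ ≤ E * (‖v‖ ^ 2 + 1) / 2 := by
    refine htail.trans ?_
    gcongr
  calc ‖c * (a : ℂ) ^ (1 - s) / (1 - s)‖ + ‖mellin ((Ioi a).indicator (v : ℝ → ℂ)) (1 - s)‖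
      ≤ ‖c‖ * E + E * (‖v‖ ^ 2 + 1) / 2 := add_le_add hpolar htail'
    _ = (‖c‖ + (‖v‖ ^ 2 + 1) / 2) * E := by ring

/-- `‖1/ζ(s)‖ ≤ C_ζ` on `Re s ≥ 2`. [folklore] -/
private theorem exists_bound_inv_zeta :
    ∃ C : ℝ, 0 ≤ C ∧ ∀ s : ℂ, 2 ≤ s.re → ‖(riemannZeta s)⁻¹‖ ≤ C :=
  ⟨∑' k : ℕ, (k : ℝ) ^ (-(2 : ℝ)), tsum_nonneg fun k ↦ Real.rpow_nonneg k.cast_nonneg _,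
    fun _ hs ↦ BurnolResidueSum.norm_inv_zeta_le_of_two_le_re hs⟩

/-- **The left functional equation for `θ`**: for `v ∈ L_a`, `θ = G_v/ζ` off the zeros, and
`Re s ≤ −1` with `ζ(s) ≠ 0`: `θ(s) = G_{𝓕v}(1−s)/ζ(1−s)` (Prop. 2.2 (v) for `G_v` and `Λ(s) = Λ(1−s)`;
the printed "`θ(1−s) = 𝓕₊(g)^(s)/ζ(s)`"). [cite: Burnol2004b, proof of Prop. 6.1 (arXiv:math/0203120v7 p. 15, TeX l.1217–1222)] -/
theorem theta_eq_left {a : ℝ} (ha : 0 < a) {v : Lp ℂ 2 (volume : Measure ℝ)} (hv : v ∈ sonineL a)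
    (hθ : ∀ s, s ≠ 1 → riemannZeta s ≠ 0 → θ s = rightMellinExt v s * 1 / riemannZeta s)
    {s : ℂ} (hs : s.re ≤ -1) (hζ : riemannZeta s ≠ 0) :
    θ s = rightMellinExt (𝓕 v : Lp ℂ 2 (volume : Measure ℝ)) (1 - s) / riemannZeta (1 - s) := by
  have hs1 : s ≠ 1 := by intro h; rw [h, one_re] at hs; norm_num at hs
  have hs0 : s ≠ 0 := by intro h; rw [h, zero_re] at hs; norm_num at hs
  have h1s : 2 ≤ (1 - s).re := by rw [sub_re, one_re]; linarith
  have h1s0 : 1 - s ≠ 0 := by intro h; rw [h, zero_re] at h1s; norm_num at h1s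
  have hsn : ∀ n : ℕ, s ≠ -2 * (n : ℂ) := by
    intro n hn
    rcases n with _ | k
    · exact hs0 (by simpa using hn)
    · apply hζ
      rw [hn]
      have : (-2 : ℂ) * ((k + 1 : ℕ) : ℂ) = -2 * ((k : ℂ) + 1) := by push_cast; ring
      rw [this]
      exact riemannZeta_neg_two_mul_nat_add_one k
  have hsn' : ∀ n : ℕ, s ≠ 1 + 2 * (n : ℂ) := by
    intro n hn
    have := congrArg Complex.re hn
    simp at this
    linarith [n.cast_nonneg (α := ℝ)]
  have hΓs : Gammaℝ s ≠ 0 := by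
    rw [Ne, Gammaℝ_eq_zero_iff]
    rintro ⟨n, hn⟩
    exact hsn n (by rw [hn]; ring)
  have hΓ1s : Gammaℝ (1 - s) ≠ 0 := Gammaℝ_ne_zero_of_re_pos (by linarith)
  have hζ1s : riemannZeta (1 - s) ≠ 0 := riemannZeta_ne_zero_of_one_le_re (by linarith)
  have hG : rightMellinExt v s = Gammaℝ (1 - s) / Gammaℝ s *
      rightMellinExt (𝓕 v : Lp ℂ 2 (volume : Measure ℝ)) (1 - s) :=
    BurnolLProperty.rightMellinExt_eq_chi_mul ha hv hsn hsn'
  have hZ : riemannZeta s = Gammaℝ (1 - s) / Gammaℝ s * riemannZeta (1 - s) := by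
    rw [riemannZeta_def_of_ne_zero hs0, riemannZeta_def_of_ne_zero h1s0,
      completedRiemannZeta_one_sub]
    field_simp
  rw [hθ s hs1 hζ, hG, hZ]
  field_simp

/-- **`θ = G_v/ζ` is of exponential type `log(1/a)`** (`v ∈ L_a`, `0 < a ≤ 1`, `θ` entire with
`θ = G_v/ζ` off the zeros): for every `ε > 0`, `‖θ(s)‖ ≤ A_ε e^{(−log a + ε)‖s‖}`. Right half-plane
`Re s ≥ 2`: `O(a^{−σ})`; left half-plane `Re s ≤ −1`: the functional equations; strip: maximum modulus
between Titchmarsh's good heights (`BurnolEvaluatorCompleteness.exists_bound_theta_strip_of_edges`).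
This replaces Kreĭn's theorem of the printed proof. [cite: Burnol2004, proof of Thm. 6.25 and Thm. `kreintheorem` (arXiv:math/0112254, TeX l.2582–2590, 2919–2923); Burnol2004b, proof of Prop. 6.1 (arXiv:math/0203120v7 p. 15, TeX l.1217–1231)] -/
theorem exists_expType_bound_theta {a : ℝ} (ha : 0 < a) (ha1 : a ≤ 1)
    {v : Lp ℂ 2 (volume : Measure ℝ)} (hv : v ∈ sonineL a) (hθd : Differentiable ℂ θ)
    (hθ : ∀ s, s ≠ 1 → riemannZeta s ≠ 0 → θ s = rightMellinExt v s * 1 / riemannZeta s)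
    {ε : ℝ} (hε : 0 < ε) :
    ∃ A : ℝ, ∀ s : ℂ, ‖θ s‖ ≤ A * Real.exp ((-Real.log a + ε) * ‖s‖) := by
  set L : ℝ := -Real.log a with hL
  have hL0 : 0 ≤ L := by rw [hL]; linarith [Real.log_nonpos ha.le ha1]
  have hFv : (𝓕 v : Lp ℂ 2 (volume : Measure ℝ)) ∈ sonineL a := fourier_mem_sonineL hv
  obtain ⟨K₁, hK₁0, hK₁⟩ := exists_bound_rightMellinExt_exp ha ha1 hv
  obtain ⟨K₂, hK₂0, hK₂⟩ := exists_bound_rightMellinExt_exp ha ha1 hFv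
  obtain ⟨Cζ, hCζ0, hCζ⟩ := exists_bound_inv_zeta
  -- right half-plane: `‖θ‖ ≤ K₁ Cζ e^{Lσ}`
  have hR : ∀ s : ℂ, 2 ≤ s.re → ‖θ s‖ ≤ K₁ * Cζ * Real.exp (L * s.re) := by
    intro s hs
    have hs1 : s ≠ 1 := by intro h; rw [h, one_re] at hs; norm_num at hs
    have hζ : riemannZeta s ≠ 0 := riemannZeta_ne_zero_of_one_le_re (by linarith)
    rw [hθ s hs1 hζ, mul_one, div_eq_mul_inv, norm_mul]
    calc ‖rightMellinExt v s‖ * ‖(riemannZeta s)⁻¹‖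
        ≤ (K₁ * Real.exp (-Real.log a * s.re)) * Cζ :=
          mul_le_mul (hK₁ s hs) (hCζ s hs) (norm_nonneg _) (by positivity)
      _ = K₁ * Cζ * Real.exp (L * s.re) := by rw [hL]; ring
  -- left half-plane off the zeros: `‖θ‖ ≤ K₂ Cζ e^{L(1−σ)}`
  have hLt' : ∀ s : ℂ, s.re ≤ -1 → riemannZeta s ≠ 0 →
      ‖θ s‖ ≤ K₂ * Cζ * Real.exp (L * (1 - s.re)) := by
    intro s hs hζ
    have h1s : 2 ≤ (1 - s).re := by rw [sub_re, one_re]; linarith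
    rw [theta_eq_left ha hv hθ hs hζ, div_eq_mul_inv, norm_mul]
    calc ‖rightMellinExt (𝓕 v : Lp ℂ 2 (volume : Measure ℝ)) (1 - s)‖ * ‖(riemannZeta (1 - s))⁻¹‖
        ≤ (K₂ * Real.exp (-Real.log a * (1 - s).re)) * Cζ :=
          mul_le_mul (hK₂ (1 - s) h1s) (hCζ _ h1s) (norm_nonneg _) (by positivity)
      _ = K₂ * Cζ * Real.exp (L * (1 - s.re)) := by rw [hL, sub_re, one_re]; ring
  -- left half-plane everywhere (trivial zeros by continuity along the vertical direction)
  have hLt : ∀ s : ℂ, s.re ≤ -1 → ‖θ s‖ ≤ K₂ * Cζ * Real.exp (L * (1 - s.re)) := by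
    intro s hs
    by_cases hζ : riemannZeta s = 0
    swap
    · exact hLt' s hs hζ
    set δ : ℕ → ℝ := fun n ↦ 1 / ((n : ℝ) + 1) with hδ
    have hδpos : ∀ n, 0 < δ n := fun n ↦ by rw [hδ]; positivity
    set u : ℕ → ℂ := fun n ↦ s + (δ n : ℂ) * I with hu
    have hure : ∀ n, (u n).re = s.re := fun n ↦ by simp [hu]
    have huim : ∀ n, (u n).im = s.im + δ n := fun n ↦ by simp [hu]
    have hsim : s.im = 0 := by
      obtain ⟨k, hk⟩ := (riemannZeta_eq_zero_iff_of_re_nonpos (by linarith : s.re ≤ 0)).1 hζ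
      rw [hk]; simp
    have hune : ∀ n, riemannZeta (u n) ≠ 0 := by
      intro n h0
      obtain ⟨m, hm⟩ := (riemannZeta_eq_zero_iff_of_re_nonpos (by rw [hure]; linarith)).1 h0
      have h1 := congrArg Complex.im hm
      rw [huim, hsim] at h1
      simp at h1
      linarith [hδpos n]
    have hlim : Tendsto u atTop (𝓝 s) := by
      have h1 : Tendsto δ atTop (𝓝 0) := tendsto_one_div_add_atTop_nhds_zero_nat
      have h2 : Tendsto (fun n : ℕ ↦ s + ((δ n : ℝ) : ℂ) * I) atTop (𝓝 (s + ((0 : ℝ) : ℂ) * I)) :=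
        tendsto_const_nhds.add (((continuous_ofReal.tendsto 0).comp h1).mul tendsto_const_nhds)
      simpa [hu] using h2
    have hl : Tendsto (fun n ↦ ‖θ (u n)‖) atTop (𝓝 ‖θ s‖) :=
      (continuous_norm.tendsto _).comp ((hθd.continuous.tendsto s).comp hlim)
    have hr : Tendsto (fun n ↦ K₂ * Cζ * Real.exp (L * (1 - (u n).re))) atTop
        (𝓝 (K₂ * Cζ * Real.exp (L * (1 - s.re)))) := by
      have hc : Continuous fun z : ℂ ↦ K₂ * Cζ * Real.exp (L * (1 - z.re)) := by fun_prop
      exact (hc.tendsto s).comp hlim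
    exact le_of_tendsto_of_tendsto' hl hr fun n ↦ hLt' (u n) (by rw [hure]; exact hs) (hune n)
  -- the strip `−1 ≤ Re s ≤ 2`: edges-only maximum modulus between Titchmarsh's good heights
  obtain ⟨C, hC0, M, -, hC⟩ :=
    BurnolEvaluatorCompleteness.exists_bound_theta_strip_of_edges (P := fun _ ↦ (1 : ℂ)) (CP := 1)
      (N := 0) ha hv hθd zero_le_one (fun z _ _ ↦ by simp) hθ
      (C₁ := K₁ * Cζ * Real.exp (L * 2)) (by positivity)
      (fun s hs ↦ by rw [pow_zero, mul_one, ← hs]; exact hR s (by rw [hs]))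
      (C₂ := K₂ * Cζ * Real.exp (L * 2)) (by positivity)
      (fun s hs hζ ↦ by
        rw [pow_zero, mul_one]
        have h := hLt' s hs.le hζ
        rw [hs, show (1 : ℝ) - (-1) = 2 by norm_num] at h
        exact h)
  obtain ⟨Cp, hCp0, hCp⟩ := exists_pow_le_exp M hε
  -- assembly
  set A : ℝ := K₁ * Cζ + K₂ * Cζ * Real.exp L + C * Cp with hA
  refine ⟨A, fun s ↦ ?_⟩
  have hexp1 : Real.exp (L * ‖s‖) ≤ Real.exp ((L + ε) * ‖s‖) := by
    rw [Real.exp_le_exp]; nlinarith [norm_nonneg s]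
  have hexp2 : Real.exp (ε * ‖s‖) ≤ Real.exp ((L + ε) * ‖s‖) := by
    rw [Real.exp_le_exp]; nlinarith [norm_nonneg s]
  have hE0 : 0 ≤ Real.exp ((L + ε) * ‖s‖) := (Real.exp_pos _).le
  have hp1 : 0 ≤ K₁ * Cζ := mul_nonneg hK₁0 hCζ0
  have hp2 : 0 ≤ K₂ * Cζ * Real.exp L := by positivity
  have hp3 : 0 ≤ C * Cp := mul_nonneg hC0 hCp0
  have hA1 : K₁ * Cζ ≤ A := by rw [hA]; linarith
  have hA2 : K₂ * Cζ * Real.exp L ≤ A := by rw [hA]; linarith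
  have hA3 : C * Cp ≤ A := by rw [hA]; linarith
  rcases le_or_gt 2 s.re with hs2 | hs2
  · -- `Re s ≥ 2`
    have hσ : s.re ≤ ‖s‖ := re_le_norm s
    calc ‖θ s‖ ≤ K₁ * Cζ * Real.exp (L * s.re) := hR s hs2
      _ ≤ K₁ * Cζ * Real.exp (L * ‖s‖) := by gcongr
      _ ≤ A * Real.exp ((L + ε) * ‖s‖) := mul_le_mul hA1 hexp1 (Real.exp_pos _).le (by rw [hA]; positivity)
  rcases le_or_gt s.re (-1) with hs1 | hs1
  · -- `Re s ≤ −1`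
    have hσ : 1 - s.re ≤ 1 + ‖s‖ := by
      have := abs_re_le_norm s
      rw [abs_le] at this
      linarith [this.1]
    calc ‖θ s‖ ≤ K₂ * Cζ * Real.exp (L * (1 - s.re)) := hLt s hs1
      _ ≤ K₂ * Cζ * Real.exp (L * (1 + ‖s‖)) := by gcongr
      _ = K₂ * Cζ * Real.exp L * Real.exp (L * ‖s‖) := by rw [mul_add, mul_one, Real.exp_add]; ring
      _ ≤ A * Real.exp ((L + ε) * ‖s‖) := mul_le_mul hA2 hexp1 (Real.exp_pos _).le (by rw [hA]; positivity)
  · -- the strip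
    calc ‖θ s‖ ≤ C * (1 + ‖s‖) ^ M := hC s hs1.le hs2.le
      _ ≤ C * (Cp * Real.exp (ε * ‖s‖)) := by gcongr; exact hCp ‖s‖ (norm_nonneg s)
      _ = C * Cp * Real.exp (ε * ‖s‖) := by ring
      _ ≤ A * Real.exp ((L + ε) * ‖s‖) := mul_le_mul hA3 hexp2 (Real.exp_pos _).le (by rw [hA]; positivity)

/-- **`θ` is square integrable on the line `Re s = 2`**: there `θ = G_v/ζ` with `|1/ζ| ≤ C_ζ` and
`G_v(2+iτ) = c·a^{−1−iτ}/(−1−iτ) + (𝟙_{(a,∞)}v)^(2+iτ)`, the first term `O(1/|τ|)`, the second in `L²(dτ)`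
by Mellin–Plancherel (`L²(a,∞) ≅ A^s ℍ²`). [cite: Burnol2004, proof of Thm. `thml2` ("On `Re(s)=2`, `F(s)` is square integrable because `F(s)ζ(s)…` belongs to `ℍ²`", arXiv:math/0112254 TeX l.2880–2884); Burnol2004b, §4 (arXiv:math/0203120v7 p. 7, TeX l.633–638)] -/
theorem integrable_sq_theta_line {a : ℝ} (ha : 0 < a) {v : Lp ℂ 2 (volume : Measure ℝ)}
    (hv : v ∈ sonineL a) (hθd : Differentiable ℂ θ)
    (hθ : ∀ s, s ≠ 1 → riemannZeta s ≠ 0 → θ s = rightMellinExt v s * 1 / riemannZeta s) :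
    Integrable (fun τ : ℝ ↦ ‖θ (2 + τ * I)‖ ^ 2) := by
  obtain ⟨c, hvc⟩ := hv.2.1
  have hex : ∃ G, HasRightMellinContinuation v G :=
    ⟨_, hasRightMellinContinuation_rightMellinExt_of_mem_sonineL ha hv⟩
  obtain ⟨Cζ, hCζ0, hCζ⟩ := exists_bound_inv_zeta
  have hline : ∀ τ : ℝ, ((2 : ℂ) + τ * I).re = 2 := fun τ ↦ by simp
  have hne1 : ∀ τ : ℝ, (2 : ℂ) + τ * I ≠ 1 := by
    intro τ h; have := congrArg Complex.re h; simp at this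
  -- the tail transform on the line is in `L²`
  set φ₀ : ℝ → ℂ := (Ioi a).indicator (v : ℝ → ℂ) with hφ₀
  have hφ₀m : MemLp φ₀ 2 volume := (Lp.memLp v).indicator measurableSet_Ioi
  have hφ₀0 : ∀ᵐ t : ℝ, t ≤ a → φ₀ t = 0 :=
    Eventually.of_forall fun t ht ↦ by
      rw [hφ₀, indicator_of_notMem (fun h : t ∈ Ioi a ↦ not_lt.2 ht h)]
  obtain ⟨-, CH, hH⟩ := isHardyRight_cpow_mul_rightMellin_of_memLp ha hφ₀m hφ₀0
  obtain ⟨hmem, -⟩ := hH 2 (by norm_num)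
  have hM2 : Integrable (fun τ : ℝ ↦ ‖mellin φ₀ (1 - (2 + τ * I))‖ ^ 2) := by
    have h1 := (memLp_two_iff_integrable_sq_norm hmem.1).1 hmem
    have h2 := h1.const_mul ((a ^ (2 : ℝ))⁻¹ ^ 2)
    refine h2.congr (Eventually.of_forall fun τ ↦ ?_)
    have e2 : ((2 : ℝ) : ℂ) = 2 := by norm_num
    simp only [e2]
    rw [norm_mul, norm_cpow_eq_rpow_re_of_pos ha, hline τ, mul_pow, ← mul_assoc, ← mul_pow,
      inv_mul_cancel₀ (Real.rpow_pos_of_pos ha _).ne', one_pow, one_mul]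
    rfl
  -- the polar term on the line is in `L²`
  have hP2 : Integrable (fun τ : ℝ ↦ ‖c * (a : ℂ) ^ (1 - (2 + τ * I)) / (1 - (2 + τ * I))‖ ^ 2) := by
    have h := (integrable_inv_one_add_sq.const_mul ((‖c‖ * a ^ (-1 : ℝ)) ^ 2))
    refine h.congr (Eventually.of_forall fun τ ↦ ?_)
    simp only
    have hns : ‖(1 : ℂ) - (2 + τ * I)‖ ^ 2 = 1 + τ ^ 2 := by
      rw [show (1 : ℂ) - (2 + τ * I) = ((-1 : ℝ) : ℂ) + ((-τ : ℝ) : ℂ) * I by push_cast; ring,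
        Complex.sq_norm, Complex.normSq_add_mul_I]
      ring
    rw [norm_div, norm_mul, norm_cpow_eq_rpow_re_of_pos ha, div_pow, hns]
    simp only [sub_re, one_re, add_re, mul_re, ofReal_re, I_re, ofReal_im, I_im, re_ofNat]
    ring_nf
  -- `‖θ‖² ≤ 2 Cζ² (‖polar‖² + ‖tail‖²)` on the line
  have hθcont : Continuous fun τ : ℝ ↦ θ (2 + τ * I) := hθd.continuous.comp (by fun_prop)
  refine ((hP2.add hM2).const_mul (2 * Cζ ^ 2)).mono' (hθcont.norm.pow 2).aestronglyMeasurable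
    (Eventually.of_forall fun τ ↦ ?_)
  rw [Real.norm_eq_abs, abs_of_nonneg (by positivity)]
  have hs : (2 : ℝ) ≤ ((2 : ℂ) + τ * I).re := by rw [hline]
  have hζ : riemannZeta (2 + τ * I) ≠ 0 := riemannZeta_ne_zero_of_one_le_re (by rw [hline]; norm_num)
  rw [hθ _ (hne1 τ) hζ, mul_one, div_eq_mul_inv, norm_mul, mul_pow,
    BurnolLProperty.rightMellinExt_eq_polar_add_mellin ha hvc hex (by rw [hline]; norm_num) (hne1 τ)]
  have hG := norm_add_le (c * (a : ℂ) ^ (1 - (2 + τ * I)) / (1 - (2 + τ * I)))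
    (mellin φ₀ (1 - (2 + τ * I)))
  have hζb := hCζ _ hs
  set P := ‖c * (a : ℂ) ^ (1 - (2 + τ * I)) / (1 - (2 + τ * I))‖ with hPdef
  set Q := ‖mellin φ₀ (1 - (2 + τ * I))‖ with hQdef
  set Z := ‖(riemannZeta (2 + ↑τ * I))⁻¹‖ with hZdef
  have hsum : ‖c * (a : ℂ) ^ (1 - (2 + τ * I)) / (1 - (2 + τ * I)) + mellin φ₀ (1 - (2 + τ * I))‖ ^ 2
      ≤ 2 * (P ^ 2 + Q ^ 2) := by
    calc _ ≤ (P + Q) ^ 2 := by gcongr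
      _ ≤ 2 * (P ^ 2 + Q ^ 2) := by nlinarith [sq_nonneg (P - Q)]
  have hZ2 : Z ^ 2 ≤ Cζ ^ 2 := by
    have hZ0 : 0 ≤ Z := norm_nonneg _
    gcongr
  calc ‖c * (a : ℂ) ^ (1 - (2 + τ * I)) / (1 - (2 + τ * I)) + mellin φ₀ (1 - (2 + τ * I))‖ ^ 2 * Z ^ 2
      ≤ (2 * (P ^ 2 + Q ^ 2)) * Cζ ^ 2 :=
        mul_le_mul hsum hZ2 (sq_nonneg _) (by positivity)
    _ = 2 * Cζ ^ 2 * (P ^ 2 + Q ^ 2) := by ring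

/-- **The rotated function `F(z) = θ(2 − iz)` is entire of exponential type `≤ −log a` and square
integrable on `ℝ`** — the hypotheses of the Paley–Wiener theorem
`Literature.Analysis.Complex.paleyWiener_of_isEntireOfExpTypeLE`.
[cite: Burnol2004, proof of Thm. 6.25 (`omegaprime2`, arXiv:math/0112254 TeX l.2919–2925)] -/
theorem expType_and_sq_integrable_theta_rot {a : ℝ} (ha : 0 < a) (ha1 : a ≤ 1)
    {v : Lp ℂ 2 (volume : Measure ℝ)} (hv : v ∈ sonineL a) (hθd : Differentiable ℂ θ)
    (hθ : ∀ s, s ≠ 1 → riemannZeta s ≠ 0 → θ s = rightMellinExt v s * 1 / riemannZeta s) :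
    Literature.Analysis.Complex.IsEntireOfExpTypeLE (fun z ↦ θ (2 - I * z)) (-Real.log a) ∧
      Integrable (fun x : ℝ ↦ ‖(fun z ↦ θ (2 - I * z)) x‖ ^ 2) := by
  have hL0 : 0 ≤ -Real.log a := by linarith [Real.log_nonpos ha.le ha1]
  constructor
  · refine ⟨hθd.comp (by fun_prop), fun ε hε ↦ ?_⟩
    obtain ⟨A, hA⟩ := exists_expType_bound_theta ha ha1 hv hθd hθ hε
    have hA0 : 0 ≤ A := by
      have h := (norm_nonneg _).trans (hA 0)
      rw [norm_zero, mul_zero, Real.exp_zero, mul_one] at h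
      exact h
    refine ⟨A * Real.exp ((-Real.log a + ε) * 2), fun z ↦ (hA (2 - I * z)).trans ?_⟩
    have hn : ‖(2 : ℂ) - I * z‖ ≤ 2 + ‖z‖ := by
      calc ‖(2 : ℂ) - I * z‖ ≤ ‖(2 : ℂ)‖ + ‖I * z‖ := norm_sub_le _ _
        _ = 2 + ‖z‖ := by rw [norm_mul, Complex.norm_I, one_mul]; norm_num
    have hLε : 0 ≤ -Real.log a + ε := by linarith
    calc A * Real.exp ((-Real.log a + ε) * ‖(2 : ℂ) - I * z‖)
        ≤ A * Real.exp ((-Real.log a + ε) * (2 + ‖z‖)) := by gcongr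
      _ = A * Real.exp ((-Real.log a + ε) * 2) * Real.exp ((-Real.log a + ε) * ‖z‖) := by
          rw [mul_add, Real.exp_add]; ring
  · have h := (integrable_sq_theta_line ha hv hθd hθ).comp_neg
    refine h.congr (Eventually.of_forall fun x ↦ ?_)
    simp only
    congr 3
    push_cast
    ring

/-- `((e^u : ℝ) : ℂ)^w = e^{uw}` for real `u`. [folklore] -/
private theorem ofReal_exp_cpow (u : ℝ) (w : ℂ) : ((Real.exp u : ℝ) : ℂ) ^ w = cexp (u * w) := by
  rw [Complex.ofReal_exp, Complex.cpow_def_of_ne_zero (Complex.exp_ne_zero _),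
    Complex.log_exp (by simp [Real.pi_pos]) (by simp [Real.pi_pos.le])]

/-- `u ↦ e^{u}` is a `C¹` bijection `ℝ → (0,∞)`. [folklore] -/
private theorem rexp_hasDerivWithinAt :
    ∀ x ∈ (univ : Set ℝ), HasDerivWithinAt Real.exp (Real.exp x) univ x :=
  fun x _ ↦ (Real.hasDerivAt_exp x).hasDerivWithinAt

/-- `exp` maps `ℝ` onto `(0,∞)`. [folklore] -/
private theorem rexp_image : Real.exp '' univ = Ioi 0 := by
  rw [Set.image_univ, Real.range_exp]

/-- **The annihilator of the evaluators lies in the co-Poisson subspace** (`0 < a < 1`):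
`{f ∈ L_a | ∀ (ρ,k), ⟪Y^a_{ρ,k}, f⟫ = 0} ⊆ P_a` — the inclusion `⊆` of [Burnol2004b, Thm. 3.1,
clause 3], printed as "we refer the reader to [Burnol2004, Thms. 6.24, 6.25]". Road (Kreĭn-free):
`θ := G_{f̄}/ζ` is entire (`BurnolEvaluatorCompleteness.exists_theta`), of exponential type `log(1/a)`
(`exists_expType_bound_theta`) and `L²` on `Re s = 2` (`integrable_sq_theta_line`); the classical
Paley–Wiener theorem (`paleyWiener_of_isEntireOfExpTypeLE`) applied to `z ↦ θ(2 − iz)` gives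
`θ(s) = ∫_{log a}^{−log a} φ(u)e^{(2−s)u}du = ĝ(s)` with `g(x) = φ(log x)·x ∈ L¹(a, 1/a)`; hence
`G_{f̄} = ζ·ĝ` and §C identifies `f̄`, then `f`, as a co-Poisson sum.
[cite: Burnol2004b, Thm. 3.1 clause 3 (arXiv:math/0203120v7 p. 6, TeX l.516–525) and §6 (TeX l.1294–1300); Burnol2004, Thm. 6.25 (`omegaprime2`, arXiv:math/0112254 TeX l.2897–2955)] -/
theorem sonineL_inter_orthogonal_subset_coPoissonP {a : ℝ} (ha : 0 < a) (ha1 : a < 1) :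
    {f | f ∈ sonineL a ∧ ∀ p : ZetaZeroIndex, inner ℂ (burnolYSystem a p) f = 0} ⊆
      coPoissonP a := by
  rintro f ⟨hf, horth⟩
  -- the conjugate class `v = f̄ ∈ L_a` and the orders of `G_v` at the non-trivial zeros
  set v : Lp ℂ 2 (volume : Measure ℝ) := star f with hvdef
  have hvf : (v : ℝ → ℂ) =ᵐ[volume] fun x ↦ conj ((f : ℝ → ℂ) x) := by
    filter_upwards [Lp.coeFn_star f] with x hx
    rw [hvdef, hx]
    rfl
  have hv : v ∈ sonineL a := BurnolEvaluators.mem_sonineL_of_conj hf hvf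
  have hvan : ∀ ρ ∈ ZetaZeros.riemannZetaNontrivialZeros, ρ ∉ (∅ : Finset ℂ) →
      (((riemannZetaZeroOrder ρ).toNat : ℕ) : ℕ∞) ≤ analyticOrderAt (rightMellinExt v) ρ := by
    intro ρ hρ _
    refine BurnolEvaluatorCompleteness.le_analyticOrderAt_of_burnolEval_eq_zero ha hv hρ fun k hk ↦ ?_
    exact BurnolEvaluatorCompleteness.burnolEval_conj_eq_zero ha hf hvf ⟨(ρ, k), hρ, hk⟩ (horth _)
  -- `θ := G_v/ζ` is entire
  obtain ⟨θ, hθd, -, hθ⟩ := BurnolEvaluatorCompleteness.exists_theta ha hv (P := fun _ ↦ (1 : ℂ))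
    (fun s ↦ analyticAt_const) ∅ (by simp) hvan
  -- Paley–Wiener for `z ↦ θ(2 − iz)`
  set L : ℝ := -Real.log a with hL
  have hL0 : 0 ≤ L := by rw [hL]; linarith [Real.log_nonpos ha.le ha1.le]
  obtain ⟨hF, hF2⟩ := expType_and_sq_integrable_theta_rot ha ha1.le hv hθd hθ
  obtain ⟨φ, hφ1, -, hφ0, hφF⟩ :=
    Literature.Analysis.Complex.paleyWiener_of_isEntireOfExpTypeLE hL0 hF hF2
  -- `θ(s) = ∫ φ(u) e^{(2−s)u} du`
  have hθrep : ∀ s : ℂ, θ s = ∫ u : ℝ, φ u * cexp ((2 - s) * u) := by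
    intro s
    have h := hφF (I * (s - 2))
    have e : (2 : ℂ) - I * (I * (s - 2)) = s := by ring_nf; rw [I_sq]; ring
    simp only [e] at h
    rw [h]
    refine integral_congr_ae (Eventually.of_forall fun u ↦ ?_)
    ring_nf
    rw [I_sq]
    ring
  -- the datum `g(x) = φ(log x)·x` on `(a, 1/a)`
  set g : ℝ → ℂ := fun x ↦ if x ∈ Ioo a a⁻¹ then φ (Real.log x) * (x : ℂ) else 0 with hgdef
  have hgz : ∀ t, t ∉ Ioo a a⁻¹ → g t = 0 := fun t ht ↦ by
    show (if t ∈ Ioo a a⁻¹ then φ (Real.log t) * (t : ℂ) else 0) = 0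
    rw [if_neg ht]
  have hlogainv : Real.log a⁻¹ = L := by rw [Real.log_inv, hL]
  have hiff : ∀ u : ℝ, Real.exp u ∈ Ioo a a⁻¹ ↔ u ∈ Ioo (Real.log a) L := by
    intro u
    rw [mem_Ioo, mem_Ioo, ← Real.log_lt_iff_lt_exp ha, ← hlogainv,
      ← Real.lt_log_iff_exp_lt (inv_pos.2 ha)]
  -- the pulled-back integrands `e^u g(e^u) = 𝟙_{(log a, L)}(u) φ(u) e^{2u}`
  set w : ℝ → ℂ := fun u ↦ if u ∈ Ioo (Real.log a) L then ((Real.exp u ^ 2 : ℝ) : ℂ) else 0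
    with hwdef
  have hw_meas : AEStronglyMeasurable w volume := by
    have hc : Continuous fun u : ℝ ↦ ((Real.exp u ^ 2 : ℝ) : ℂ) := by fun_prop
    have : w = (Ioo (Real.log a) L).indicator fun u : ℝ ↦ ((Real.exp u ^ 2 : ℝ) : ℂ) := by
      funext u; simp only [hwdef, indicator]
    rw [this]
    exact hc.aestronglyMeasurable.indicator measurableSet_Ioo
  have hw_bdd : ∀ u : ℝ, ‖w u‖ ≤ Real.exp L ^ 2 := by
    intro u
    by_cases hu : u ∈ Ioo (Real.log a) L
    · have h1 : ‖w u‖ = Real.exp u ^ 2 := by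
        rw [hwdef]
        simp only [if_pos hu, Complex.norm_real, Real.norm_eq_abs, abs_pow,
          abs_of_pos (Real.exp_pos u)]
      rw [h1]
      gcongr
      exact hu.2.le
    · rw [hwdef]; simp only [if_neg hu, norm_zero]; positivity
  have hpull : ∀ u : ℝ, |Real.exp u| • g (Real.exp u) = φ u * w u := by
    intro u
    rw [abs_of_pos (Real.exp_pos u)]
    by_cases hu : u ∈ Ioo (Real.log a) L
    · have hu' : Real.exp u ∈ Ioo a a⁻¹ := (hiff u).2 hu
      simp only [hgdef, hwdef, if_pos hu', if_pos hu, Real.log_exp, Complex.real_smul]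
      push_cast
      ring
    · have hu' : Real.exp u ∉ Ioo a a⁻¹ := fun h ↦ hu ((hiff u).1 h)
      simp only [hgdef, hwdef, if_neg hu', if_neg hu, smul_zero, mul_zero]
  have hgi' : IntegrableOn g (Ioi 0) := by
    rw [← rexp_image, integrableOn_image_iff_integrableOn_abs_deriv_smul MeasurableSet.univ
      rexp_hasDerivWithinAt Real.exp_injective.injOn, integrableOn_univ]
    simp only [hpull]
    exact hφ1.mul_bdd hw_meas (Eventually.of_forall hw_bdd)
  have hgi : IntegrableOn g (Ioo a a⁻¹) := hgi'.mono_set fun x hx ↦ ha.trans hx.1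
  -- `ĝ = θ`
  have hgθ : ∀ s : ℂ, rightMellin g s = θ s := by
    intro s
    rw [hθrep s, rightMellin, mellin, ← rexp_image,
      integral_image_eq_integral_abs_deriv_smul MeasurableSet.univ rexp_hasDerivWithinAt
        Real.exp_injective.injOn, Measure.restrict_univ]
    -- the two integrands agree off the two points `log a`, `L`
    have hnull : ∀ᵐ u : ℝ, u ∉ ({Real.log a, L} : Set ℝ) := by
      have : volume ({Real.log a, L} : Set ℝ) = 0 :=
        ((Set.finite_singleton L).insert (Real.log a)).measure_zero volume
      exact compl_mem_ae_iff.2 this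
    refine integral_congr_ae ?_
    filter_upwards [hnull] with u hu
    rw [show (1 : ℂ) - s - 1 = -s by ring, smul_comm, hpull u, ofReal_exp_cpow, smul_eq_mul]
    by_cases hu' : u ∈ Ioo (Real.log a) L
    · simp only [hwdef, if_pos hu', Complex.ofReal_pow, Complex.ofReal_exp]
      rw [sq, ← Complex.exp_add, mul_left_comm, ← Complex.exp_add]
      congr 2
      ring
    · -- off `[log a, L]` both sides vanish (`φ = 0` off `Icc (−L) L`, `log a = −L`)
      have hφu : φ u = 0 := by
        apply hφ0
        intro hmem
        rw [mem_Icc] at hmem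
        simp only [mem_insert_iff, mem_singleton_iff, not_or] at hu
        have hla : Real.log a = -L := by rw [hL, neg_neg]
        apply hu'
        exact ⟨lt_of_le_of_ne (by rw [hla]; exact hmem.1) (Ne.symm hu.1),
          lt_of_le_of_ne hmem.2 hu.2⟩
      simp [hwdef, hφu]
  -- `G_v = ζ·ĝ` on `{Re s > 1/2} ∖ {1}` off the zeros, and §C
  have hG : ∀ s : ℂ, 1 / 2 < s.re → s ≠ 1 → riemannZeta s ≠ 0 →
      rightMellinExt v s = riemannZeta s * rightMellin g s := by
    intro s _ hs1 hζ
    rw [hgθ s, hθ s hs1 hζ]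
    field_simp
  have hvP : v ∈ coPoissonP a := mem_coPoissonP_of_rightMellinExt_eq_zeta_mul ha hv hgi hgz hG
  have h := CoPoissonMellin.star_mem_coPoissonP hvP
  rwa [hvdef, star_star] at h

/-- **[Burnol2004b, Thm. 3.1, clause 3] as a set identity, `0 < a < 1`**: the annihilator of the
`Y^a_{ρ,k}` in `L_a` IS the co-Poisson subspace `P_a` — the hypothesis `hperp` of the tree's assembly
`Burnol2004b_thm3_1_of`, from `⊆` above and `⊇` = ★
`CoPoissonMellin.coPoissonP_subset_sonineL_inter_orthogonal`.
[cite: Burnol2004b, Thm. 3.1 (arXiv:math/0203120v7 p. 6, TeX l.516–525); Burnol2004, Thms. 6.24–6.25 (arXiv:math/0112254 TeX l.2815–2955)] -/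
theorem sonineL_inter_orthogonal_eq_coPoissonP :
    ∀ a : ℝ, 0 < a → a < 1 →
      {f | f ∈ sonineL a ∧ ∀ p : ZetaZeroIndex, inner ℂ (burnolYSystem a p) f = 0} =
        coPoissonP a :=
  fun _ ha ha1 ↦ Set.Subset.antisymm (sonineL_inter_orthogonal_subset_coPoissonP ha ha1)
    (CoPoissonMellin.coPoissonP_subset_sonineL_inter_orthogonal ha)

end Assembly

end CoPoissonPerp

/-- **Burnol 2004b, Thm. 3.1 (discharge).** "The vectors `Y^a_{ρ,k}`, `0 ≤ k < m_ρ`, associated with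
the non-trivial zeros of the Riemann zeta function, are a minimal system in `L_a` if and only if
`a ≤ 1`. They are a complete system if and only if `a ≥ 1`. For `a < 1` the perpendicular complement to
`Y_a` is the co-Poisson subspace `P_a`. For `a > 1` we may omit arbitrarily (finitely) many of the
`Y^a_{ρ,k}`'s and still have a complete system in `L_a`." Assembled by the tree's
`Burnol2004b_thm3_1_of` from Props. 6.1, 6.2 (★ `BurnolEvaluatorCompletenessProofs`), Thm. 6.3
(★ `BurnolZetaSystemsSectionSixHolds`), Prop. 6.4 (★ `BurnolCoPoissonEvaluatorOrthogonality`) and the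
identification `Y_a^⊥ ∩ L_a = P_a` (`CoPoissonPerp.sonineL_inter_orthogonal_eq_coPoissonP`). RH-FREE:
the zeros of `ζ` enter as an index set, wherever they lie. Discharges
`Literature.NumberTheory.LFunctions.Burnol2004b_thm3_1`.
[cite: Burnol2004b, Thm. 3.1 (arXiv:math/0203120v7 p. 6, TeX l.516–525)] -/
theorem Burnol2004b_thm3_1_holds : Burnol2004b_thm3_1 :=
  Burnol2004b_thm3_1_of Burnol2004b_prop6_1_holds Burnol2004b_prop6_2_holds
    Burnol2004b_thm6_3_holds Burnol2004b_prop6_4_holds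
    CoPoissonPerp.sonineL_inter_orthogonal_eq_coPoissonP

end Literature.NumberTheory.LFunctions
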